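import Summits.BirchSwinnertonDyer.BirchSwinnertonDyer.Theses.ErratumRoadFive
import Summits.BirchSwinnertonDyer.BirchSwinnertonDyer.Theorems.ErratumRoadFiveKolyvaginRestTam
import HarnessLib

/-!
# Route `ErratumRoadFive` (rung K2a): crux `RamNoErratumDataAtFive` (item stmt-BirchSwinnertonDyer-19624, REST‴)
# BY NAME ⟸ the Kolyvagin road at `p ≥ 5` on (α) ∩ Locus + its Tamagawa part REST⁗
# (cell `bsd-stepL`, seat `bsd-stepL-imc-p1` g5; `--supports stmt-BirchSwinnertonDyer-19624`)

HONEST FRAMING. THEOREMS ONLY (no definition, no named fact, no `sorry`); nothing here proves the crux; BSD is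
proved for no pair; every published ∕ cited named fact is a HYPOTHESIS, bound BY NAME through the route's support
items where the route declares them (`PublishedInputsFive` 19066, `JSWAnticyclotomicControlMult` 19626) and
otherwise through the Literature facts themselves (Shimura reciprocity at conductor 1
`heegnerPointOfConductor_one_galoisConj`, McCallum's structure theorem
`McCallum1991_pow_dvd_card_sha_primary_of_certificate`, Darmon Thm. 3.6
`phi_heegnerTau_mem_range_map_singularModuliField` — the last conjuncts of the KOLY route's support
`PublishedInputsKolyThree`). The Kolyvagin non-vanishing statement `hZα` is a HYPOTHESIS (∀-frame ♯ typing at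
`p ≥ 5` on the (α) ∩ Locus pairs at Hoffstein–Luo fields — the shape of `Theses.KolyvaginRoadThree.ZhangSharpFrameAtThreeHL`
with `3 ↦ p ≥ 5` and the (α) binder added; Skinner–Zhang arXiv:1407.1099 Thm. 1.3 on its ♠-locus, PREPRINT; the
cell's refereed memo THEOREM SZ14♯ on the Locus); REST⁗ (`hrest`) is the crux's own body with the extra binder
`p ∣ ∏ c_ℓ`. This module imports the route file, so the route file cannot import it (the Theses-free kernels are
`ErratumRoadFiveKolyvaginKernelHLFive` ∕ `ErratumRoadFiveKolyvaginRestTam`).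

## What this file proves

* `ramNoErratumDataAtFive_of_kolyvaginFramesHLAlpha_of_restTam : PublishedInputsFive → JSWAnticyclotomicControlMult →
  (Shimura reciprocity) → (McCallum) → (Darmon 3.6) → hZα → REST⁗ → RamNoErratumDataAtFive` — the crux BY NAME.
* `restTam_of_ramNoErratumDataAtFive : RamNoErratumDataAtFive → REST⁗` — converse bookkeeping (the planner's split
  `RamNoErratumDataAtFive ⟺ [Kolyvagin part] ∧ REST⁗` loses nothing on the REST⁗ side).
* `openInputOnTree_onLocus_of_publishedInputsFive_of_kolyvaginFramesHL` — class level on the whole Locus at `p ≥ 5`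
  with the published facts bound by the route's support item.
* §2 (append) `ramNoErratumDataAtFive_of_kolyvaginFramesHL_of_restTam` — the crux from the LOCUS-WIDE hypothesis `hZ₅`
  (KOLY's crux shape with `3 ↦ p ≥ 5`, no (α) binder) + REST⁗.

CENSUS (class-wide cw pairs, `p ≥ 5`, `N < 5·10⁵`; in-seat fold of multr1-p1 `census2_all_500k`, 3 s): REST‴ ∩ (ram)
= 703 204 ⟶ REST⁗ = 22 480 (= (α) ∩ {p ∣ ∏c} 19 909 [every ramified witness split 17 298, only `q = 2` non-split
2 611] + (β) 2 571); the Kolyvagin part (α) ∩ Locus = 680 724 (every ramified witness split 531 672, only `q = 2`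
149 052). CONDITIONAL on every binder; nothing booked; no census number of record moves.

References (locators only): [cite: SkinnerZhang2014, Thm. 1.3 (§1 p. 3), §12.3 — shape of `hZα`]
[cite: McCallumLMS1991, §5 Cor. 5.6 (p. 310)] [cite: Darmon2004, Thm. 3.6 (PDF pp. 43–44)]
[cite: GrossLMS1991, §4 (4.1)] [cite: JetchevSkinnerWan2017, Thm. 3.3.1, §7.4.1] [cite: Castella2018Erratum, Thm. 1.1 (iii)–(iv)].
-/

noncomputable section

open scoped Classical

set_option linter.dupNamespace false

namespace Summit.BirchSwinnertonDyer.BirchSwinnertonDyer.Theorems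

open WeierstrassCurve Literature.NumberTheory.EllipticCurves
  Literature.NumberTheory.EllipticCurves.ModularForms
  Literature.NumberTheory.EllipticCurves.Rank1Residual
  Summit.BirchSwinnertonDyer.Rank1Residual Summit.BirchSwinnertonDyer.Rank1Residual.X11b
  Summit.BirchSwinnertonDyer.BirchSwinnertonDyer.Theses.ErratumRoadFive

/-- **Crux `RamNoErratumDataAtFive` (REST‴, item 19624) BY NAME from the Kolyvagin road on (α) ∩ Locus and REST⁗.**
Binders: the route's support conjunction `PublishedInputsFive` (Gross–Zagier, Kolyvagin ×2, Skinner 2016 Thm C,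
Wuthrich, GZK, modularity, newforms, Hoffstein–Luo, Friedberg–Hoffstein ×2, Mazur, BDMTV, Poitou–Tate, local
Euler–Poincaré — only nine of them are used); the route's by-name leaf `JSWAnticyclotomicControlMult` (JSW17 Thm.
3.3.1-mult, control identity at every pair); Shimura reciprocity at conductor 1 (`hrec`), McCallum (`hMc`), Darmon
Thm. 3.6 (`h36`) — Literature named facts, PUB; `hZα` — Kolyvagin's conjecture mod `p` at every Manin-good
conductor-1 frame of every Hoffstein–Luo field of every (α) ∩ Locus pair, `p ≥ 5` (HYPOTHESIS, crux-shaped); `hrest` —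
REST⁗, the crux's body with `p ∣ ∏ c_ℓ` added (HYPOTHESIS, crux-shaped). Proof: the Theses-free kernel
`Koly.ramNoErratumData_of_kolyvaginFramesHLAlpha_of_restTam`. CONDITIONAL on every binder; nothing booked.
[cite: SkinnerZhang2014, Thm. 1.3 (shape of `hZα`)] [cite: McCallumLMS1991, §5 Cor. 5.6 (p. 310)]
[cite: Darmon2004, Thm. 3.6 (PDF pp. 43–44)] [cite: JetchevSkinnerWan2017, Thm. 3.3.1] -/
theorem ramNoErratumDataAtFive_of_kolyvaginFramesHLAlpha_of_restTam
    (hF : PublishedInputsFive) (h331 : JSWAnticyclotomicControlMult)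
    (hrec : ∀ (N : ℕ) [NeZero N] (W : WeierstrassCurve ℚ) (K : Type) [Field K] [NumberField K],
      heegnerPointOfConductor_one_galoisConj N W K)
    (hMc : McCallum1991_pow_dvd_card_sha_primary_of_certificate)
    (h36 : ∀ (N : ℕ) [NeZero N] (W : WeierstrassCurve ℚ) (K : Type) [Field K] [NumberField K],
      phi_heegnerTau_mem_range_map_singularModuliField N W K)
    (hZα : ∀ (W : WeierstrassCurve ℚ) [W.IsElliptic] [W.IsGloballyMinimal] [NeZero (W.conductorNorm ℤ)]
      (p : ℕ) [hp : Fact p.Prime] (K : Type) [Field K] [NumberField K]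
      (Dt : ModularParametrizationData W (W.conductorNorm ℤ)) (β : ℤ) (ι : K →+* ℂ),
      ClassX11b W p → 5 ≤ p → W.HasMultiplicativeReductionAtPrime p → Rank1Residual.Surj W p →
      Rank1Residual.Ram W p → ¬ p ∣ W.tamagawaProduct →
      (∀ (q : ℕ) [Fact q.Prime], q ≠ 2 → q ≠ p → Rank1Residual.Mult W q →
        ¬ W.HasSplitMultiplicativeReductionAtPrime q → p ∣ padicValInt q W.minimalDiscriminantInt) →
      IsImaginaryQuadratic K → Odd (NumberField.discr K) →
      SatisfiesHeegnerHypothesis (W.conductorNorm ℤ) K →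
      (W.quadraticTwist (NumberField.discr K : ℚ)).entireLFunction 1 ≠ 0 →
      NumberField.discr K ≠ -3 →
      (4 * (W.conductorNorm ℤ : ℤ)) ∣ β ^ 2 - NumberField.discr K → ¬ (p : ℤ) ∣ Dt.c →
      ∃ (n : ℕ) (d : KolyvaginHeegnerData Dt β ι n),
        KolyvaginDescent.KolSupp (Zhang2014.IsKolyvaginPrime (W.conductorNorm ℤ) W K p) n ∧
          d.kolyvaginClass hp.out 1 ≠ 0)
    (hrest : ∀ (W : WeierstrassCurve ℚ) [W.IsElliptic] [W.IsGloballyMinimal] (p : ℕ) [Fact p.Prime],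
      Rank1Residual.Ram W p →
      ¬ ((∃ (q : ℕ) (_ : Fact q.Prime), q ≠ 2 ∧ q ≠ p ∧ Rank1Residual.Mult W q ∧
            ¬ W.HasSplitMultiplicativeReductionAtPrime q ∧ ¬ p ∣ padicValInt q W.minimalDiscriminantInt) ∧
          (∀ P : (W.baseChange ℚ_[p]).toAffine.Point, p • P = 0 → P = 0)) →
      p ∣ W.tamagawaProduct → P2OpenInputOnTreeAt W p) :
    RamNoErratumDataAtFive := by
  obtain ⟨hGZ, hKo, hB, hSk, -, hGZK, hmod, hnf, hHL, -, hMaz, -, -, -, -⟩ := hF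
  intro W _ _ p _ hram hno
  exact Three.Koly.ramNoErratumData_of_kolyvaginFramesHLAlpha_of_restTam hGZ hKo hB hSk hGZK hmod hnf hHL hMaz hrec hMc
    h36 h331 hZα hrest W p hram hno

/-- **Converse bookkeeping BY NAME: the crux implies its Tamagawa part REST⁗** (so a planner split
`RamNoErratumDataAtFive ⟸ [Kolyvagin part hZα] + REST⁗` loses nothing on the REST⁗ side). [folklore] -/
theorem restTam_of_ramNoErratumDataAtFive (h : RamNoErratumDataAtFive) :
    ∀ (W : WeierstrassCurve ℚ) [W.IsElliptic] [W.IsGloballyMinimal] (p : ℕ) [Fact p.Prime],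
      Rank1Residual.Ram W p →
      ¬ ((∃ (q : ℕ) (_ : Fact q.Prime), q ≠ 2 ∧ q ≠ p ∧ Rank1Residual.Mult W q ∧
            ¬ W.HasSplitMultiplicativeReductionAtPrime q ∧ ¬ p ∣ padicValInt q W.minimalDiscriminantInt) ∧
          (∀ P : (W.baseChange ℚ_[p]).toAffine.Point, p • P = 0 → P = 0)) →
      p ∣ W.tamagawaProduct → P2OpenInputOnTreeAt W p :=
  fun W _ _ p _ hram hno _ ↦ h W p hram hno

/-- **The Kolyvagin road on the WHOLE Locus at `p ≥ 5`, published facts bound by the route's support items**: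
`PublishedInputsFive` + `JSWAnticyclotomicControlMult` + Shimura reciprocity + McCallum + Darmon 3.6 + `hZ₅`
(Kolyvagin's conjecture mod `p`, ∀-frame ♯ typing at Hoffstein–Luo fields, on every Locus pair, `p ≥ 5`) ⟹ route
p2's open input at every X11b pair with `p ≥ 5`, a (ram) witness and `p ∤ ∏ c_ℓ` (cw 2 093 111 — the erratum
locus of the asides 19061 ∕ 19274 included). CONDITIONAL on every binder; nothing booked.
[cite: SkinnerZhang2014, Thm. 1.3 (shape of `hZ₅`)] [cite: McCallumLMS1991, §5 Cor. 5.6 (p. 310)]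
[cite: Darmon2004, Thm. 3.6] [cite: JetchevSkinnerWan2017, Thm. 3.3.1] -/
theorem openInputOnTree_onLocus_of_publishedInputsFive_of_kolyvaginFramesHL
    (hF : PublishedInputsFive) (h331 : JSWAnticyclotomicControlMult)
    (hrec : ∀ (N : ℕ) [NeZero N] (W : WeierstrassCurve ℚ) (K : Type) [Field K] [NumberField K],
      heegnerPointOfConductor_one_galoisConj N W K)
    (hMc : McCallum1991_pow_dvd_card_sha_primary_of_certificate)
    (h36 : ∀ (N : ℕ) [NeZero N] (W : WeierstrassCurve ℚ) (K : Type) [Field K] [NumberField K],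
      phi_heegnerTau_mem_range_map_singularModuliField N W K)
    (hZ₅ : ∀ (W : WeierstrassCurve ℚ) [W.IsElliptic] [W.IsGloballyMinimal] [NeZero (W.conductorNorm ℤ)]
      (p : ℕ) [hp : Fact p.Prime] (K : Type) [Field K] [NumberField K]
      (Dt : ModularParametrizationData W (W.conductorNorm ℤ)) (β : ℤ) (ι : K →+* ℂ),
      ClassX11b W p → 5 ≤ p → W.HasMultiplicativeReductionAtPrime p → Rank1Residual.Surj W p →
      Rank1Residual.Ram W p → ¬ p ∣ W.tamagawaProduct →
      IsImaginaryQuadratic K → Odd (NumberField.discr K) →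
      SatisfiesHeegnerHypothesis (W.conductorNorm ℤ) K →
      (W.quadraticTwist (NumberField.discr K : ℚ)).entireLFunction 1 ≠ 0 →
      NumberField.discr K ≠ -3 →
      (4 * (W.conductorNorm ℤ : ℤ)) ∣ β ^ 2 - NumberField.discr K → ¬ (p : ℤ) ∣ Dt.c →
      ∃ (n : ℕ) (d : KolyvaginHeegnerData Dt β ι n),
        KolyvaginDescent.KolSupp (Zhang2014.IsKolyvaginPrime (W.conductorNorm ℤ) W K p) n ∧
          d.kolyvaginClass hp.out 1 ≠ 0) :
    ∀ (W : WeierstrassCurve ℚ) [W.IsElliptic] [W.IsGloballyMinimal] (p : ℕ) [Fact p.Prime],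
      ClassX11b W p → 5 ≤ p → Rank1Residual.Ram W p → ¬ p ∣ W.tamagawaProduct →
      P2OpenInputOnTreeAt W p := by
  obtain ⟨hGZ, hKo, hB, hSk, -, hGZK, hmod, hnf, hHL, -, hMaz, -, -, -, -⟩ := hF
  exact Three.Koly.openInputOnTree_onLocus_of_kolyvaginFramesHL_of_thm331Mult hGZ hKo hB hSk hGZK hmod hnf hHL hMaz
    hrec hMc h36 h331 hZ₅

/-! ## §2 (append, imc-p1 g5) The crux from the Locus-wide Kolyvagin hypothesis `hZ₅` (KOLY's crux shape at `p ≥ 5`) -/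

/-- **Crux `RamNoErratumDataAtFive` BY NAME from the LOCUS-WIDE Kolyvagin hypothesis `hZ₅` + REST⁗** — the variant of
`ramNoErratumDataAtFive_of_kolyvaginFramesHLAlpha_of_restTam` whose Kolyvagin binder is EXACTLY the KOLY route's deciding
crux shape `Theses.KolyvaginRoadThree.ZhangSharpFrameAtThreeHL` with `3 ↦ p ≥ 5` (no (α) binder: Kolyvagin's conjecture
mod `p` at every Manin-good conductor-1 frame of every Hoffstein–Luo field of EVERY Locus pair — the statement a K2-twin
of the KOLY route would file, cw 2 093 111; by `ErratumRoadFiveKolyvaginFramesTight` it is equivalent to `BSD(E,p)` on the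
Locus modulo the published inputs). `hZ₅ ⟹ hZα` by ignoring the binder. CONDITIONAL on every binder; nothing booked.
[cite: SkinnerZhang2014, Thm. 1.3 (shape of `hZ₅`)] [cite: McCallumLMS1991, §5 Cor. 5.6 (p. 310)]
[cite: Darmon2004, Thm. 3.6 (PDF pp. 43–44)] [cite: JetchevSkinnerWan2017, Thm. 3.3.1] -/
theorem ramNoErratumDataAtFive_of_kolyvaginFramesHL_of_restTam
    (hF : PublishedInputsFive) (h331 : JSWAnticyclotomicControlMult)
    (hrec : ∀ (N : ℕ) [NeZero N] (W : WeierstrassCurve ℚ) (K : Type) [Field K] [NumberField K],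
      heegnerPointOfConductor_one_galoisConj N W K)
    (hMc : McCallum1991_pow_dvd_card_sha_primary_of_certificate)
    (h36 : ∀ (N : ℕ) [NeZero N] (W : WeierstrassCurve ℚ) (K : Type) [Field K] [NumberField K],
      phi_heegnerTau_mem_range_map_singularModuliField N W K)
    (hZ₅ : ∀ (W : WeierstrassCurve ℚ) [W.IsElliptic] [W.IsGloballyMinimal] [NeZero (W.conductorNorm ℤ)]
      (p : ℕ) [hp : Fact p.Prime] (K : Type) [Field K] [NumberField K]
      (Dt : ModularParametrizationData W (W.conductorNorm ℤ)) (β : ℤ) (ι : K →+* ℂ),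
      ClassX11b W p → 5 ≤ p → W.HasMultiplicativeReductionAtPrime p → Rank1Residual.Surj W p →
      Rank1Residual.Ram W p → ¬ p ∣ W.tamagawaProduct →
      IsImaginaryQuadratic K → Odd (NumberField.discr K) →
      SatisfiesHeegnerHypothesis (W.conductorNorm ℤ) K →
      (W.quadraticTwist (NumberField.discr K : ℚ)).entireLFunction 1 ≠ 0 →
      NumberField.discr K ≠ -3 →
      (4 * (W.conductorNorm ℤ : ℤ)) ∣ β ^ 2 - NumberField.discr K → ¬ (p : ℤ) ∣ Dt.c →
      ∃ (n : ℕ) (d : KolyvaginHeegnerData Dt β ι n),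
        KolyvaginDescent.KolSupp (Zhang2014.IsKolyvaginPrime (W.conductorNorm ℤ) W K p) n ∧
          d.kolyvaginClass hp.out 1 ≠ 0)
    (hrest : ∀ (W : WeierstrassCurve ℚ) [W.IsElliptic] [W.IsGloballyMinimal] (p : ℕ) [Fact p.Prime],
      Rank1Residual.Ram W p →
      ¬ ((∃ (q : ℕ) (_ : Fact q.Prime), q ≠ 2 ∧ q ≠ p ∧ Rank1Residual.Mult W q ∧
            ¬ W.HasSplitMultiplicativeReductionAtPrime q ∧ ¬ p ∣ padicValInt q W.minimalDiscriminantInt) ∧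
          (∀ P : (W.baseChange ℚ_[p]).toAffine.Point, p • P = 0 → P = 0)) →
      p ∣ W.tamagawaProduct → P2OpenInputOnTreeAt W p) :
    RamNoErratumDataAtFive :=
  ramNoErratumDataAtFive_of_kolyvaginFramesHLAlpha_of_restTam hF h331 hrec hMc h36
    (fun W _ _ _ p _ K _ _ Dt β ι hX hp5 hmult hs hram htam _ hK hodd hH hLt h3 hβ hc ↦
      hZ₅ W p K Dt β ι hX hp5 hmult hs hram htam hK hodd hH hLt h3 hβ hc)
    hrest

end Summit.BirchSwinnertonDyer.BirchSwinnertonDyer.Theorems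

end
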